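import Summits.KontsevichZagierPeriods.Zeta5Search.Certificates.RayC5KernelBricks
import HarnessLib

/-!
# ζ(5) search — certificates: CLASS-LAW WINDOWS of the ray RayC5 as a table source of the kernel multiplier (TYPER g17)

HONEST FRAMING: systematic search; no irrationality claim unless certified.  `p`-adic bookkeeping of explicit rationals; nothing here
is a statement about `ζ(5)`; every exponent this machine feeds is `< 1` (no irrationality content).

OUR work (Summit side; typer seat, generation 17; generator `HOME/pub-zeta5-typer-g17/gen/gen_kernelclass.py C5`).  Port of p3 g6's
table design (`RecordRayDenominatorsBricksClass`: a LIST of class-law windows + ONE decidable check) onto typer g16's `RayKernel` frame for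
the T1-map ray `bC5 n`.  The census LETTERS column of this ray (the PROVED class laws M/J/B/O/… of the tree, evaluated per `θ`-window by
the census engine) becomes kernel-assemblable WITHOUT per-window Lean:

* `CWin` — a class-law window record `⟨a₁, a₂, b₁, b₂, N₀, B⟩` standing for the tree theorem
  `CWin.Holds c : ∀ n ≥ N₀, ∀ p prime, a₁n < a₂p → b₂p ≤ b₁n → Cas₇(b(n)) ≠ 0 → B ≤ v_p(Cas₇(b(n)))` (`b(n) = bC5 n`; the window
  theorems of P1 g13 / p3's face machine are put in this normal form by three-line adapters in the round files);
* `fL c e = ⌊c/B⌋`, `fU c e = ⌈c/A⌉ − 1` — bounds of the integer part `⌊c·n/p⌋` on a table window `(A, B]` (`fL_le`, `le_fU`), hence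
  bounds `vNlo` / `vRhi` of `v_p(N♯(b)) = v_p(N♯(b′))` and `v_p(ρ(a·n))` from `RayC5KernelCellVals` (pointwise `k`, no constancy needed);
* `classCond cw NT e` (source kind `8j+5`): `e = (A, B, k, 8j+5)` lies inside `cw[j]` with `1 ≤ A ≤ B ≤ 23`, `N₀ ≤ NT`, and
  `k ≤ 9 + 2·vNlo + B_j`, `k ≤ 9 + 2·vNlo − vRhi`; soundness `class_entry_cert` (generic `RayKernel.cell_cert`) under `∀ c ∈ cw, c.Holds`;
* ENTRY-LEVEL forms of typer g16's two sources: `atlas_entry_cert` (`atlasCond`, the 17 landed `atlasCert_*` via `atlas_dispatch`) and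
  `brick_entry_cert` (`brickCond`, fam-denom `ν`-cells with shifts `m ≤ 3` via `cell_brick_shift_c5`), and the ONE checker
  `entryOK cw NT = classCond ∨ atlasCond ∨ brickCond` with `entry_cert` / `entryOK_basic` (`n ≥ NT ≥ 816`).
The table multiplier and the exponent of ANY checked table are in `RayC5KernelClassTable`.
-/

noncomputable section

open Finset

namespace Summit.KontsevichZagierPeriods.Zeta5Search.RayC5

open Summit.KontsevichZagierPeriods.Zeta5Search.DualSeries
open Summit.KontsevichZagierPeriods.Zeta5Search.DualSeriesDenominators
open Summit.KontsevichZagierPeriods.Zeta5Search.WedgeDictionary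
open Summit.KontsevichZagierPeriods.Zeta5Search.RayKernel
open Summit.KontsevichZagierPeriods.Zeta5Search.Denom.DigitCert
open Summit.KontsevichZagierPeriods.Zeta5Search.CasoratianValuation (casoratian shift)
open Literature.NumberTheory.Irrationality.Hata1992

/-! ### Class-law windows -/

/-- A CLASS-LAW WINDOW of the ray: `θ = p/n ∈ (a₁/a₂, b₁/b₂]`, valid from `n ≥ N0`, Casoratian floor `B`. -/
structure CWin where
  /-- left endpoint numerator -/
  a1 : ℕ
  /-- left endpoint denominator -/
  a2 : ℕ
  /-- right endpoint numerator -/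
  b1 : ℕ
  /-- right endpoint denominator -/
  b2 : ℕ
  /-- least `n` -/
  N0 : ℕ
  /-- the bound `B ≤ v_p(Cas₇(b(n)))` -/
  B : ℤ

/-- The statement a class-law window stands for (normal form of the tree's window theorems on this ray). -/
def CWin.Holds (c : CWin) : Prop :=
  ∀ n p : ℕ, c.N0 ≤ n → p.Prime → c.a1 * n < c.a2 * p → c.b2 * p ≤ c.b1 * n →
    casoratian (bC5 n) 7 ≠ 0 → c.B ≤ padicValRat p (casoratian (bC5 n) 7)

/-! ### Integer parts on a table window -/

/-- Lower bound of `⌊c·n/p⌋` on the window `(A, B]`: `⌊c/B⌋`. -/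
def fL (c : ℕ) (e : WinEntry) : ℤ := ⌊(c : ℚ) / e.2.1⌋

/-- Upper bound of `⌊c·n/p⌋` on the window `(A, B]`: `⌈c/A⌉ − 1`. -/
def fU (c : ℕ) (e : WinEntry) : ℤ := ⌈(c : ℚ) / e.1⌉ - 1

/-- `⌊c/B⌋ ≤ ⌊c·n/p⌋` for `p ≤ B·n`, `B > 0`. -/
theorem fL_le {c : ℕ} {e : WinEntry} {n p : ℕ} (hp : 0 < p) (hB : 0 < e.2.1) (hhi : (p : ℚ) ≤ e.2.1 * n) :
    fL c e ≤ ((c * n / p : ℕ) : ℤ) := by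
  unfold fL
  set v : ℤ := ⌊(c : ℚ) / e.2.1⌋ with hv
  have hvle : (v : ℚ) ≤ (c : ℚ) / e.2.1 := Int.floor_le _
  rcases lt_or_ge v 0 with hneg | hnn
  · have : (0 : ℤ) ≤ ((c * n / p : ℕ) : ℤ) := by positivity
    omega
  · have hvB : (v : ℚ) * e.2.1 ≤ c := by rwa [le_div_iff₀ hB] at hvle
    have key : (v : ℚ) * p ≤ (c : ℚ) * n := by
      calc (v : ℚ) * p ≤ (v : ℚ) * (e.2.1 * n) := mul_le_mul_of_nonneg_left hhi (by exact_mod_cast hnn)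
        _ = ((v : ℚ) * e.2.1) * n := by ring
        _ ≤ (c : ℚ) * n := mul_le_mul_of_nonneg_right hvB (by positivity)
    have key' : v.toNat * p ≤ c * n := by
      have : ((v.toNat : ℕ) : ℚ) = (v : ℚ) := by exact_mod_cast Int.toNat_of_nonneg hnn
      exact_mod_cast (show ((v.toNat : ℕ) : ℚ) * p ≤ (c : ℚ) * n by rw [this]; exact key)
    have h2 : v.toNat ≤ c * n / p := (Nat.le_div_iff_mul_le hp).2 key'
    have h3 : (v.toNat : ℤ) = v := Int.toNat_of_nonneg hnn
    omega

/-- `⌊c·n/p⌋ ≤ ⌈c/A⌉ − 1` for `A·n < p`, `A > 0`, `c ≥ 1`. -/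
theorem le_fU {c : ℕ} (hc : 0 < c) {e : WinEntry} {n p : ℕ} (hp : 0 < p) (hA : 0 < e.1) (hlo : e.1 * n < (p : ℚ)) :
    ((c * n / p : ℕ) : ℤ) ≤ fU c e := by
  unfold fU
  set u : ℤ := ⌈(c : ℚ) / e.1⌉ with hu
  have hule : (c : ℚ) / e.1 ≤ u := Int.le_ceil _
  have hcA : 0 < (c : ℚ) / e.1 := div_pos (by exact_mod_cast hc) hA
  have hu0 : 0 ≤ u := by exact_mod_cast hcA.le.trans hule
  have hcu : (c : ℚ) ≤ (u : ℚ) * e.1 := by rwa [div_le_iff₀ hA] at hule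
  have key : (c : ℚ) * n < (u : ℚ) * p := by
    have h1 : (c : ℚ) * n ≤ (u : ℚ) * e.1 * n := mul_le_mul_of_nonneg_right hcu (by positivity)
    have h2 : (u : ℚ) * e.1 * n = (u : ℚ) * (e.1 * n) := by ring
    rcases hu0.lt_or_eq with hupos | hu00
    · have h3 : (u : ℚ) * (e.1 * n) < (u : ℚ) * p := mul_lt_mul_of_pos_left hlo (by exact_mod_cast hupos)
      linarith
    · exfalso
      rw [← hu00] at hcu
      simp at hcu
      have : (0 : ℚ) < c := by exact_mod_cast hc
      linarith
  have key' : c * n < u.toNat * p := by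
    have : ((u.toNat : ℕ) : ℚ) = (u : ℚ) := by exact_mod_cast Int.toNat_of_nonneg hu0
    exact_mod_cast (show (c : ℚ) * n < ((u.toNat : ℕ) : ℚ) * p by rw [this]; exact key)
  have h2 : c * n / p < u.toNat := (Nat.div_lt_iff_lt_mul hp).2 key'
  have h3 : (u.toNat : ℤ) = u := Int.toNat_of_nonneg hu0
  omega

/-- Lower bound of `v_p(N♯(b)) = v_p(N♯(b′))` on a table window (blocks `[17, 18, 20, 22, 20, 18]` minus `⌊19n/p⌋`, `⌊18n/p⌋`). -/
def vNlo (e : WinEntry) : ℤ := fL 17 e + fL 18 e + fL 20 e + fL 22 e + fL 20 e + fL 18 e - fU 19 e - fU 18 e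

/-- Upper bound of `v_p(ρ(a·n))` on a table window (fifteen numerator parts minus six denominator parts). -/
def vRhi (e : WinEntry) : ℤ := (fU 11 e + fU 12 e + fU 14 e + fU 15 e + fU 14 e + fU 16 e + fU 17 e + fU 19 e + fU 17 e + fU 20 e + fU 21 e + fU 23 e + fU 23 e + fU 24 e + fU 26 e) - (fL 21 e + fL 16 e + fL 15 e + fL 13 e + fL 12 e + fL 39 e)

/-- **The class branch of the checker** for an entry `(A, B, k, 8·j + 5)` (decidable): `j` indexes a window of `cw`,
`1 ≤ A ≤ B ≤ 23`, `(A, B] ⊆ (a₁/a₂, b₁/b₂]` (`a₁ ≤ a₂A`, `B·b₂ ≤ b₁`, `0 < a₂`), `N₀ ≤ NT`, and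
`k ≤ 9 + 2·vNlo + B_j`, `k ≤ 9 + 2·vNlo − vRhi`. -/
def classCond (cw : List CWin) (NT : ℕ) (e : WinEntry) : Bool :=
  decide (e.2.2.2 % 8 = 5) && decide (e.2.2.2 / 8 < cw.length) &&
  (let c := cw.getD (e.2.2.2 / 8) ⟨0, 1, 0, 1, 0, 0⟩
   decide (1 ≤ e.1) && decide (e.1 ≤ e.2.1) && decide (e.2.1 ≤ 23) &&
   decide ((c.a1 : ℚ) ≤ (c.a2 : ℚ) * e.1) && decide (e.2.1 * (c.b2 : ℚ) ≤ (c.b1 : ℚ)) && decide (0 < c.a2) &&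
   decide (c.N0 ≤ NT) &&
   decide ((e.2.2.1 : ℤ) ≤ 9 + 2 * vNlo e + c.B) && decide ((e.2.2.1 : ℤ) ≤ 9 + 2 * vNlo e - vRhi e))

/-- Unpacking the class branch. -/
theorem classCond_sound {cw : List CWin} {NT : ℕ} {e : WinEntry} (h : classCond cw NT e = true) :
    ∃ c ∈ cw, 1 ≤ e.1 ∧ e.1 ≤ e.2.1 ∧ e.2.1 ≤ 23 ∧ (c.a1 : ℚ) ≤ (c.a2 : ℚ) * e.1 ∧ e.2.1 * (c.b2 : ℚ) ≤ (c.b1 : ℚ) ∧ 0 < c.a2 ∧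
      c.N0 ≤ NT ∧ (e.2.2.1 : ℤ) ≤ 9 + 2 * vNlo e + c.B ∧ (e.2.2.1 : ℤ) ≤ 9 + 2 * vNlo e - vRhi e := by
  simp only [classCond, Bool.and_eq_true, decide_eq_true_eq, and_assoc] at h
  obtain ⟨-, hlen, h1, h2, h3, h4, h5, h6, h7, h8, h9⟩ := h
  refine ⟨cw.getD (e.2.2.2 / 8) ⟨0, 1, 0, 1, 0, 0⟩, ?_, h1, h2, h3, h4, h5, h6, h7, h8, h9⟩
  rw [List.getD_eq_getElem _ _ hlen]
  exact List.getElem_mem hlen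

/-- **Soundness of the class branch**: under `∀ c ∈ cw, c.Holds`, a prime of a class entry's window carries
`p^k ∣ wedgeNumZ b b′` and `p^k ∣ qNumZ b b′` (`n ≥ NT ≥ 816`; generic `RayKernel.cell_cert` with the exact valuations of
`RayC5KernelCellVals` bounded through `fL_le` / `le_fU`). -/
theorem class_entry_cert {cw : List CWin} (hcw : ∀ c ∈ cw, c.Holds) {NT : ℕ} (hNT : 816 ≤ NT) {e : WinEntry}
    (h : classCond cw NT e = true) {n : ℕ} (hn : NT ≤ n) {p : ℕ}
    (hp : p ∈ windowPrimes ((e.1 : ℚ) : ℝ) ((e.2.1 : ℚ) : ℝ) n) :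
    (p : ℤ) ^ e.2.2.1 ∣ wedgeNumZ (bC5 n) (bC5' n) ∧ (p : ℤ) ^ e.2.2.1 ∣ qNumZ (bC5 n) (bC5' n) := by
  obtain ⟨c, hc, hA1, hAB, hBlo, ha, hb, ha2, hN0, hk1, hk2⟩ := classCond_sound h
  clear h
  have hApos : (0 : ℚ) < e.1 := by linarith
  have hBpos : (0 : ℚ) < e.2.1 := by linarith
  have hA0 : (0 : ℝ) ≤ ((e.1 : ℚ) : ℝ) := by exact_mod_cast hApos.le
  obtain ⟨hpr, hlow, hhigh⟩ := (mem_windowPrimes_iff hA0).1 hp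
  haveI := Fact.mk hpr
  have hp0 : 0 < p := hpr.pos
  have hloq : e.1 * (n : ℚ) < p := by exact_mod_cast hlow
  have hhiq : (p : ℚ) ≤ e.2.1 * n := by exact_mod_cast hhigh
  have hn1 : 1 ≤ n := by omega
  have hnq : (816 : ℚ) ≤ n := by exact_mod_cast (le_trans hNT hn)
  have hnpq : (n : ℚ) < p := by nlinarith
  have hnp : n < p := by exact_mod_cast hnpq
  have hpBq : (p : ℚ) ≤ 23 * n := by nlinarith
  have hpB0 : p ≤ 51 * n := by exact_mod_cast (show (p : ℚ) ≤ 51 * n by nlinarith)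
  have hp2 : p ≠ 2 := by rintro rfl; omega
  have hsqN : 22 * n < p ^ 2 := by nlinarith
  have hsqR : 39 * n < p ^ 2 := by nlinarith
  have hsqB : 51 * n < p ^ 2 := by nlinarith
  -- the class-law window theorem
  have hw1 : c.a1 * n < c.a2 * p := by
    have h1 : (c.a1 : ℚ) * n ≤ (c.a2 : ℚ) * e.1 * n := mul_le_mul_of_nonneg_right ha (by positivity)
    have h2 : (c.a2 : ℚ) * e.1 * n < (c.a2 : ℚ) * p := by
      have := mul_lt_mul_of_pos_left hloq (show (0 : ℚ) < c.a2 by exact_mod_cast ha2)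
      linarith [this]
    exact_mod_cast (show (c.a1 : ℚ) * n < (c.a2 : ℚ) * p by linarith)
  have hw2 : c.b2 * p ≤ c.b1 * n := by
    have h1 : (c.b2 : ℚ) * p ≤ (c.b2 : ℚ) * (e.2.1 * n) := mul_le_mul_of_nonneg_left hhiq (by positivity)
    have h2 : (c.b2 : ℚ) * (e.2.1 * n) = (e.2.1 * c.b2) * n := by ring
    have h3 : (e.2.1 * c.b2) * (n : ℚ) ≤ (c.b1 : ℚ) * n := mul_le_mul_of_nonneg_right hb (by positivity)
    exact_mod_cast (show (c.b2 : ℚ) * p ≤ (c.b1 : ℚ) * n by linarith)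
  have hcas := hcw c hc n p (le_trans hN0 hn) hpr hw1 hw2
  rw [casoratian, bC5_shift] at hcas
  have hd : padicValRat p (dOf0 (bC5 n)) = 1 := by
    apply padicValRat_dOf0_eq_one
    · rw [bn_bC5_zero]; exact hpB0
    · rw [bn_bC5_zero]
      have h' : ((51 * n : ℕ) : ℤ) < ((p ^ 2 : ℕ) : ℤ) := by exact_mod_cast hsqB
      exact_mod_cast h'
  have hvN := padicValRat_sharpNormaliser_bC5 (n := n) hpr hsqN
  have hvN' := padicValRat_sharpNormaliser_bC5' hn1 hpr hnp (by omega) hsqN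
  have hvr := padicValRat_rhoOf_aC5 (n := n) hpr hp2 hsqR
  have hq := qminor_floor_of_int (p := p) (rhoOf_aC5_ne_zero n) (c5Q_eq_wedge hn1)
  rw [hvr] at hq
  -- integer-part bounds on the window
  have l11 := fL_le (c := 11) hp0 hBpos hhiq
  have u11 := le_fU (c := 11) (by norm_num) hp0 hApos hloq
  have l12 := fL_le (c := 12) hp0 hBpos hhiq
  have u12 := le_fU (c := 12) (by norm_num) hp0 hApos hloq
  have l13 := fL_le (c := 13) hp0 hBpos hhiq
  have u13 := le_fU (c := 13) (by norm_num) hp0 hApos hloq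
  have l14 := fL_le (c := 14) hp0 hBpos hhiq
  have u14 := le_fU (c := 14) (by norm_num) hp0 hApos hloq
  have l15 := fL_le (c := 15) hp0 hBpos hhiq
  have u15 := le_fU (c := 15) (by norm_num) hp0 hApos hloq
  have l16 := fL_le (c := 16) hp0 hBpos hhiq
  have u16 := le_fU (c := 16) (by norm_num) hp0 hApos hloq
  have l17 := fL_le (c := 17) hp0 hBpos hhiq
  have u17 := le_fU (c := 17) (by norm_num) hp0 hApos hloq
  have l18 := fL_le (c := 18) hp0 hBpos hhiq
  have u18 := le_fU (c := 18) (by norm_num) hp0 hApos hloq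
  have l19 := fL_le (c := 19) hp0 hBpos hhiq
  have u19 := le_fU (c := 19) (by norm_num) hp0 hApos hloq
  have l20 := fL_le (c := 20) hp0 hBpos hhiq
  have u20 := le_fU (c := 20) (by norm_num) hp0 hApos hloq
  have l21 := fL_le (c := 21) hp0 hBpos hhiq
  have u21 := le_fU (c := 21) (by norm_num) hp0 hApos hloq
  have l22 := fL_le (c := 22) hp0 hBpos hhiq
  have u22 := le_fU (c := 22) (by norm_num) hp0 hApos hloq
  have l23 := fL_le (c := 23) hp0 hBpos hhiq
  have u23 := le_fU (c := 23) (by norm_num) hp0 hApos hloq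
  have l24 := fL_le (c := 24) hp0 hBpos hhiq
  have u24 := le_fU (c := 24) (by norm_num) hp0 hApos hloq
  have l26 := fL_le (c := 26) hp0 hBpos hhiq
  have u26 := le_fU (c := 26) (by norm_num) hp0 hApos hloq
  have l39 := fL_le (c := 39) hp0 hBpos hhiq
  have u39 := le_fU (c := 39) (by norm_num) hp0 hApos hloq
  simp only [vNlo, vRhi] at hk1 hk2
  refine cell_cert (sharpAdmissible_bC5 hn1) (sharpAdmissible_bC5' hn1) (bn0_bC5' n) hd hvN hvN' hcas hq ?_ ?_
  · push_cast at *; linarith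
  · push_cast at *; linarith

/-! ### Entry-level certificates of typer g16's two sources -/

/-- **Atlas entries** (`atlasCond`, kind `8j+7`): the landed `atlasCert_*` of `RayC5KernelAtlasWin*` through `atlas_dispatch`
(`n ≥ 816`). -/
theorem atlas_entry_cert {e : WinEntry} (h : atlasCond e = true) {n : ℕ} (hn : 816 ≤ n) {p : ℕ}
    (hp : p ∈ windowPrimes ((e.1 : ℚ) : ℝ) ((e.2.1 : ℚ) : ℝ) n) :
    (p : ℤ) ^ e.2.2.1 ∣ wedgeNumZ (bC5 n) (bC5' n) ∧ (p : ℤ) ^ e.2.2.1 ∣ qNumZ (bC5 n) (bC5' n) := by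
  simp only [atlasCond, Bool.and_eq_true, decide_eq_true_eq] at h
  obtain ⟨⟨⟨⟨⟨⟨⟨-, hj⟩, hlo'⟩, hhi'⟩, hk'⟩, hA1⟩, hAB⟩, -⟩ := h
  have hA0 : (0 : ℝ) ≤ ((e.1 : ℚ) : ℝ) := by exact_mod_cast (show (0:ℚ) ≤ e.1 by linarith)
  obtain ⟨hpr, hlow, hhigh⟩ := (mem_windowPrimes_iff hA0).1 hp
  have hlow' : e.1 * (n : ℚ) < p := by exact_mod_cast hlow
  have hhigh' : (p : ℚ) ≤ e.2.1 * n := by exact_mod_cast hhigh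
  have hn0 : (0 : ℚ) ≤ n := by positivity
  have h1 : aLo (e.2.2.2 / 8) * n < p := lt_of_le_of_lt (mul_le_mul_of_nonneg_right hlo' hn0) hlow'
  have h2 : (p : ℚ) ≤ aHi (e.2.2.2 / 8) * n := hhigh'.trans (mul_le_mul_of_nonneg_right hhi' hn0)
  have hd := atlas_dispatch hn hpr hj h1 h2
  exact ⟨(pow_dvd_pow (p : ℤ) hk').trans hd.1, (pow_dvd_pow (p : ℤ) hk').trans hd.2⟩

/-- Unpacking the brick branch for a general entry. -/
theorem brickCond_sound {e : WinEntry} (h : brickCond e = true) :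
    ∃ C : Cell, ∃ m : ℕ, C ∈ c5Cells ∧ m ≤ 3 ∧ (C.b1 : ℚ) ≤ ((C.a1 : ℚ) + (m : ℚ) * C.b1) * e.1 ∧
      ((C.a0 : ℚ) + (m : ℚ) * C.b0) * e.2.1 ≤ (C.b0 : ℚ) ∧ 0 < C.a1 ∧ 0 < C.a0 ∧ C.a0 < (C.b0 : ℤ) ∧ C.a1 ≤ (C.b1 : ℤ) ∧ 0 < C.b1 ∧
      ((e.2.2.1 : ℤ) ≤ 2 * C.c) ∧ 1 ≤ ((m : ℚ) + 1) * e.1 ∧ e.1 ≤ e.2.1 ∧ e.2.1 ≤ 23 ∧ C.b0 ≤ 51 ∧ C.b1 ≤ 51 := by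
  simp only [brickCond, Bool.and_eq_true, decide_eq_true_eq, and_assoc] at h
  obtain ⟨hlen, hm, h1, h2, h3, h4, h5, h6, h7, h8, h9, h10, h11, h12, h13⟩ := h
  refine ⟨c5Cells.getD (e.2.2.2 / 8) ⟨0, 1, 0, 1, 0, []⟩, e.2.2.2 % 8, ?_, hm, h1, h2, h3, h4, h5, h6, h7, h8, h9, h10, h11, h12, h13⟩
  rw [List.getD_eq_getElem _ _ hlen]
  exact List.getElem_mem hlen

/-- **Brick entries** (`brickCond`, kind `8i+m`, shifts `m ≤ 3`): the certified `ν`-cells through `cell_brick_shift_c5`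
(`n ≥ 816`; typer g16's `brick_window_cert`, stated for a general entry). -/
theorem brick_entry_cert {e : WinEntry} (h : brickCond e = true) {n : ℕ} (hn : 816 ≤ n) {p : ℕ}
    (hp : p ∈ windowPrimes ((e.1 : ℚ) : ℝ) ((e.2.1 : ℚ) : ℝ) n) :
    (p : ℤ) ^ e.2.2.1 ∣ wedgeNumZ (bC5 n) (bC5' n) ∧ (p : ℤ) ^ e.2.2.1 ∣ qNumZ (bC5 n) (bC5' n) := by
  obtain ⟨C, m, hC, hm, h1, h2, ha1, ha0, ha0b0, ha1b1, hb1pos, hk, hA1, hAB, hBlo, hb0, hb1⟩ := brickCond_sound h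
  clear h
  have hm1 : (0 : ℚ) < (m : ℚ) + 1 := by positivity
  have hApos : (0 : ℚ) < e.1 := by nlinarith
  have hA0 : (0 : ℝ) ≤ ((e.1 : ℚ) : ℝ) := by exact_mod_cast hApos.le
  obtain ⟨hpr, hlow, hhigh⟩ := (mem_windowPrimes_iff hA0).1 hp
  have hlow' : e.1 * (n : ℚ) < p := by exact_mod_cast hlow
  have hhigh' : (p : ℚ) ≤ e.2.1 * n := by exact_mod_cast hhigh
  have hn1 : 1 ≤ n := by omega
  have hnq : (816 : ℚ) ≤ n := by exact_mod_cast hn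
  have hn0 : (0 : ℚ) ≤ n := by positivity
  have hmq : (m : ℚ) ≤ 3 := by exact_mod_cast hm
  have hpgt : (n : ℚ) < ((m : ℚ) + 1) * p := by nlinarith
  have hpc : (51 : ℚ) + 1 < p := by nlinarith
  have hpcN : 51 < p := by exact_mod_cast (show (51 : ℚ) < p by linarith)
  have hpB : p ≤ 51 * n := by exact_mod_cast (show (p : ℚ) ≤ 51 * n by nlinarith)
  have hsq : 51 * n < p ^ 2 := by
    have h3 : (51 : ℚ) * n * 16 ≤ (n : ℚ) * n := by nlinarith
    have h4 : (n : ℚ) * n < (((m : ℚ) + 1) * p) * (((m : ℚ) + 1) * p) := mul_self_lt_mul_self hn0 hpgt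
    have hm4 : (m : ℚ) + 1 ≤ 4 := by linarith
    have hp0' : (0 : ℚ) ≤ p := by positivity
    have h5a : ((m : ℚ) + 1) * p ≤ 4 * p := mul_le_mul_of_nonneg_right hm4 hp0'
    have h5 : (((m : ℚ) + 1) * p) * (((m : ℚ) + 1) * p) ≤ (4 * p) * (4 * (p : ℚ)) :=
      mul_le_mul h5a h5a (by positivity) (by positivity)
    have : (51 : ℚ) * n < (p : ℚ) ^ 2 := by nlinarith [h3, h4, h5]
    exact_mod_cast this
  have hx1q : (C.b1 : ℚ) * n < ((C.a1 : ℚ) + (m : ℚ) * C.b1) * p := by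
    have hpos : (0 : ℚ) < (C.a1 : ℚ) + (m : ℚ) * C.b1 := by
      have : (0 : ℚ) < C.a1 := by exact_mod_cast ha1
      have : (0 : ℚ) ≤ (m : ℚ) * C.b1 := by positivity
      linarith
    nlinarith
  have hx0le : ((C.a0 : ℚ) + (m : ℚ) * C.b0) * p ≤ (C.b0 : ℚ) * n := by
    have hpos : (0 : ℚ) < (C.a0 : ℚ) + (m : ℚ) * C.b0 := by
      have : (0 : ℚ) < C.a0 := by exact_mod_cast ha0
      have : (0 : ℚ) ≤ (m : ℚ) * C.b0 := by positivity
      linarith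
    nlinarith
  have hx1z : (C.b1 : ℤ) * n < (C.a1 + (m : ℤ) * C.b1) * p := by exact_mod_cast hx1q
  have hx0z' : (C.a0 + (m : ℤ) * C.b0) * p ≤ (C.b0 : ℤ) * n := by exact_mod_cast hx0le
  have hb0z : (0 : ℤ) < C.b0 := by have := ha0b0; linarith
  have hb1z : (0 : ℤ) < C.b1 := by exact_mod_cast hb1pos
  have hpb0 : (C.b0 : ℕ) < p := by omega
  have hx0z : (C.a0 + (m : ℤ) * C.b0) * p < (C.b0 : ℤ) * n := by
    rcases hx0z'.lt_or_eq with hlt | heq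
    · exact hlt
    · exfalso
      have hdvd : (p : ℤ) ∣ (C.b0 : ℤ) * n := ⟨C.a0 + (m : ℤ) * C.b0, by linarith⟩
      have hdvd' : p ∣ C.b0 * n := by exact_mod_cast hdvd
      rcases (Nat.Prime.dvd_mul hpr).1 hdvd' with h | h
      · exact absurd (Nat.le_of_dvd (by exact_mod_cast hb0z) h) (by omega)
      · obtain ⟨q, hq⟩ := h
        have hq' : (n : ℤ) = p * q := by exact_mod_cast hq
        rw [hq'] at heq
        have hp0 : (0 : ℤ) < p := by exact_mod_cast hpr.pos
        have e1 : C.a0 = C.b0 * ((q : ℤ) - m) := by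
          have : (p : ℤ) * (C.a0 + (m : ℤ) * C.b0 - C.b0 * q) = 0 := by linarith
          rcases mul_eq_zero.1 this with h0 | h0
          · linarith
          · linarith
        have t1 : 0 < (q : ℤ) - m := by
          by_contra hcon
          have : C.b0 * ((q : ℤ) - m) ≤ 0 := mul_nonpos_of_nonneg_of_nonpos hb0z.le (not_lt.1 hcon)
          linarith
        have t2 : (q : ℤ) - m < 1 := by
          by_contra hcon
          have : C.b0 * 1 ≤ C.b0 * ((q : ℤ) - m) := mul_le_mul_of_nonneg_left (not_lt.1 hcon) hb0z.le
          linarith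
        omega
  have hnd : ¬ p ∣ n := by
    rintro ⟨q, hq⟩
    have hq' : (n : ℤ) = p * q := by exact_mod_cast hq
    rw [hq'] at hx0z hx1z
    have hp0 : (0 : ℤ) < p := by exact_mod_cast hpr.pos
    have k0 : C.a0 + (m : ℤ) * C.b0 < C.b0 * q := lt_of_mul_lt_mul_right (by linarith [hx0z]) hp0.le
    have k1 : C.b1 * (q : ℤ) < C.a1 + (m : ℤ) * C.b1 := lt_of_mul_lt_mul_right (by linarith [hx1z]) hp0.le
    have t2 : (q : ℤ) - m < 1 := by
      by_contra hcon
      have : C.b1 * 1 ≤ C.b1 * ((q : ℤ) - m) := mul_le_mul_of_nonneg_left (not_lt.1 hcon) hb1z.le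
      linarith
    have t1 : 0 < (q : ℤ) - m := by
      by_contra hcon
      have : C.b0 * ((q : ℤ) - m) ≤ 0 := mul_nonpos_of_nonneg_of_nonpos hb0z.le (not_lt.1 hcon)
      linarith
    omega
  have hx0 : C.a0 * (p : ℤ) < (C.b0 : ℤ) * ((n : ℤ) - m * p) := by linarith
  have hx1 : (C.b1 : ℤ) * ((n : ℤ) - m * p) < C.a1 * (p : ℤ) := by linarith
  exact cell_brick_shift_c5 hC hn1 hpr hnd hpB hsq (by omega) m hx0 hx1 hk

/-! ### The one checker of a table entry -/

/-- **The checker of a window-table entry**: class branch (kind `8j+5`), atlas branch (`8j+7`) or brick branch (`8i+m`, `m ≤ 3`). -/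
def entryOK (cw : List CWin) (NT : ℕ) (e : WinEntry) : Bool := classCond cw NT e || atlasCond e || brickCond e

/-- Every checked entry is a genuine window below the big-prime atlas: `0 < A ≤ B ≤ 23`. -/
theorem entryOK_basic {cw : List CWin} {NT : ℕ} {e : WinEntry} (h : entryOK cw NT e = true) :
    0 < e.1 ∧ e.1 ≤ e.2.1 ∧ e.2.1 ≤ 23 := by
  rw [entryOK, Bool.or_eq_true, Bool.or_eq_true] at h
  rcases h with (h | h) | h
  · obtain ⟨-, -, hA1, hAB, hBlo, -⟩ := classCond_sound h
    clear h
    exact ⟨by linarith, hAB, hBlo⟩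
  · simp only [atlasCond, Bool.and_eq_true, decide_eq_true_eq] at h
    obtain ⟨⟨⟨-, hA1⟩, hAB⟩, hBlo⟩ := h
    exact ⟨by linarith, hAB, hBlo⟩
  · obtain ⟨-, m, -, -, -, -, -, -, -, -, -, -, hA1, hAB, hBlo, -⟩ := brickCond_sound h
    clear h
    have hm0 : (0 : ℚ) < (m : ℚ) + 1 := by positivity
    exact ⟨by nlinarith, hAB, hBlo⟩

/-- **Soundness of the checker**: under `∀ c ∈ cw, c.Holds` and `n ≥ NT ≥ 816`, a prime of a checked entry's window carries
`p^k ∣ wedgeNumZ b b′` and `p^k ∣ qNumZ b b′`. -/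
theorem entry_cert {cw : List CWin} (hcw : ∀ c ∈ cw, c.Holds) {NT : ℕ} (hNT : 816 ≤ NT) {e : WinEntry}
    (h : entryOK cw NT e = true) {n : ℕ} (hn : NT ≤ n) {p : ℕ}
    (hp : p ∈ windowPrimes ((e.1 : ℚ) : ℝ) ((e.2.1 : ℚ) : ℝ) n) :
    (p : ℤ) ^ e.2.2.1 ∣ wedgeNumZ (bC5 n) (bC5' n) ∧ (p : ℤ) ^ e.2.2.1 ∣ qNumZ (bC5 n) (bC5' n) := by
  rw [entryOK, Bool.or_eq_true, Bool.or_eq_true] at h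
  rcases h with (h | h) | h
  · exact class_entry_cert hcw hNT h hn hp
  · exact atlas_entry_cert h (le_trans hNT hn) hp
  · exact brick_entry_cert h (le_trans hNT hn) hp

end Summit.KontsevichZagierPeriods.Zeta5Search.RayC5
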